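import Summits.ResolutionOfSingularities.ResolutionOfSingularities.Theorems.WeightedInvariantIota3RowADominance
import Literature.AlgebraicGeometry.Resolution.FormalInverseFunction

/-!
# (F-3d) Row A dominance — TRANSPORT to an arbitrary competing flag  [OURS · L1 W4.3]

Kernel infrastructure for RE-ENTRY OBJECT #1 of chain w43 (door crux `stmt-ResolutionOfSingularities-19897`).
`RowA.rowA_secondMember_mem` (file `…Iota3RowADominance`) states ROW A for the germ written in its own frame
against the COORDINATE flag.  Here the formal coordinate change `(X₀, X₁, X₂) ↦ (X₀, v', y')` turns it into the
form of res-L1-w43-plan-1's registrar sketch (STATUS 2026-08-27T22:27:31Z): the germ is the coordinate germ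
`f = X₂^p + Λ X₁^d + X₀^M` and the competing flag `(y'; v')` is ARBITRARY with `(X₀, v', y') = 𝔪`:

* `isUnit_det_linMat_frame` — three series `(X₀, v', y')` generating `𝔪` have invertible linear part;
* `exists_ringEquiv_subst` — a substitution with zero constant terms and invertible linear part is a ring
  automorphism of `K⟦X₀,X₁,X₂⟧` (formal inverse function theorem, Literature `FormalCoordChange.exists_comp_inverse`);
* **`rowA_secondMember_mem_of_frame`** — `f ∈ F_{(y';v')}^{(q;r₁,r₂)}(N) ⇒ X₁ ∈ F_{(y';v')}^{(q;r₁,r₂)}(r₂)`.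

[OURS · L1 W4.3] NOT a statement of the manuscript; AI-produced, gate-checked, weaker than expert review.
-/

set_option linter.dupNamespace false

namespace Summit.ResolutionOfSingularities.ResolutionOfSingularities.Theorems.LocalEngine.Iota3.RowA

open MvPowerSeries IsLocalRing
open Summit.ResolutionOfSingularities.ResolutionOfSingularities.Cruxes.HypersurfaceCentreConstruction.LocalEngine.Iota3
open Literature.AlgebraicGeometry.Resolution.FormalCoordChange

variable {K : Type*} [Field K]

/-! ## Frames have invertible linear part -/

/-- Membership in `(a, b, c)` unfolded. -/
theorem exists_of_mem_span_triple {R : Type*} [CommRing R] {a b c x : R} (h : x ∈ Ideal.span {a, b, c}) :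
    ∃ r s t : R, x = r * a + s * b + t * c := by
  obtain ⟨r, z, hz, rfl⟩ := Ideal.mem_span_insert.mp h
  obtain ⟨s, t, rfl⟩ := Ideal.mem_span_pair.mp hz
  exact ⟨r, s, t, by ring⟩

/-- THREE SERIES `(X₀, v', y')` GENERATING `𝔪` HAVE INVERTIBLE LINEAR PART. -/
theorem isUnit_det_linMat_frame {v' y' : MvPowerSeries (Fin 3) K}
    (hframe : Ideal.span {(X 0 : MvPowerSeries (Fin 3) K), v', y'} = maximalIdeal (MvPowerSeries (Fin 3) K)) :
    IsUnit (linMat ![(X 0 : MvPowerSeries (Fin 3) K), v', y']).det := by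
  classical
  have hv0 : constantCoeff v' = 0 :=
    constantCoeff_eq_zero_of_mem_maximalIdeal (hframe ▸ Ideal.subset_span (by simp))
  have hy0 : constantCoeff y' = 0 :=
    constantCoeff_eq_zero_of_mem_maximalIdeal (hframe ▸ Ideal.subset_span (by simp))
  have hX : ∀ i : Fin 3, (X i : MvPowerSeries (Fin 3) K) ∈ Ideal.span {(X 0 : MvPowerSeries (Fin 3) K), v', y'} :=
    fun i => hframe ▸ mem_maximalIdeal_of_constantCoeff_eq_zero (constantCoeff_X i)
  -- linear coefficients of a combination `r X₀ + s v' + t y'` at `e₁`, `e₂`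
  have hlin : ∀ (i : Fin 3), i ≠ 0 → ∀ r s t : MvPowerSeries (Fin 3) K,
      coeff (Finsupp.single i 1) (r * X 0 + s * v' + t * y') =
        constantCoeff s * coeff (Finsupp.single i 1) v' + constantCoeff t * coeff (Finsupp.single i 1) y' := by
    intro i hi r s t
    rw [map_add, map_add, coeff_single_one_mul i r _ (constantCoeff_X 0), coeff_single_one_mul i s _ hv0,
      coeff_single_one_mul i t _ hy0, coeff_index_single_X, if_neg hi, mul_zero, zero_add]
  obtain ⟨r, s, t, h1⟩ := exists_of_mem_span_triple (hX 1)
  obtain ⟨r', s', t', h2⟩ := exists_of_mem_span_triple (hX 2)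
  have e11 := congrArg (coeff (Finsupp.single (1 : Fin 3) 1)) h1
  have e12 := congrArg (coeff (Finsupp.single (2 : Fin 3) 1)) h1
  have e22 := congrArg (coeff (Finsupp.single (2 : Fin 3) 1)) h2
  rw [hlin 1 (by decide), coeff_index_single_X, if_pos rfl] at e11
  rw [hlin 2 (by decide), coeff_index_single_X, if_neg (by decide)] at e12
  rw [hlin 2 (by decide), coeff_index_single_X, if_pos rfl] at e22
  -- the determinant
  have hθ0 : (![(X 0 : MvPowerSeries (Fin 3) K), v', y'] : Fin 3 → MvPowerSeries (Fin 3) K) 0 = X 0 := rfl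
  have hθ1 : (![(X 0 : MvPowerSeries (Fin 3) K), v', y'] : Fin 3 → MvPowerSeries (Fin 3) K) 1 = v' := rfl
  have hθ2 : (![(X 0 : MvPowerSeries (Fin 3) K), v', y'] : Fin 3 → MvPowerSeries (Fin 3) K) 2 = y' := rfl
  have h00 : coeff (Finsupp.single (0 : Fin 3) 1) (X 0 : MvPowerSeries (Fin 3) K) = 1 := coeff_index_single_self_X 0
  have h01 : coeff (Finsupp.single (1 : Fin 3) 1) (X 0 : MvPowerSeries (Fin 3) K) = 0 := by
    rw [coeff_index_single_X, if_neg (by decide)]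
  have h02 : coeff (Finsupp.single (2 : Fin 3) 1) (X 0 : MvPowerSeries (Fin 3) K) = 0 := by
    rw [coeff_index_single_X, if_neg (by decide)]
  have hdet : (linMat ![(X 0 : MvPowerSeries (Fin 3) K), v', y']).det =
      coeff (Finsupp.single 1 1) v' * coeff (Finsupp.single 2 1) y' -
        coeff (Finsupp.single 2 1) v' * coeff (Finsupp.single 1 1) y' := by
    rw [Matrix.det_fin_three]
    simp only [linMat, Matrix.of_apply, hθ0, hθ1, hθ2, h00, h01, h02, one_mul, zero_mul, sub_zero, add_zero]
  rw [hdet]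
  refine IsUnit.of_mul_eq_one (constantCoeff s * constantCoeff t' - constantCoeff t * constantCoeff s') ?_
  linear_combination (-(constantCoeff s' * coeff (Finsupp.single 2 1) v' + constantCoeff t' * coeff (Finsupp.single 2 1) y')) * e11
    - e22 + (constantCoeff s' * coeff (Finsupp.single 1 1) v' + constantCoeff t' * coeff (Finsupp.single 1 1) y') * e12

/-! ## Substitutions with invertible linear part are automorphisms -/

/-- A substitution family with zero constant terms and invertible linear part is a ring automorphism of
`K⟦X₀, …, X_{n-1}⟧` (as a `RingEquiv` whose forward map is the substitution). [folklore] -/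
theorem exists_ringEquiv_subst {n : ℕ} {θ : Fin n → MvPowerSeries (Fin n) K} (h0 : ∀ i, constantCoeff (θ i) = 0)
    (hdet : IsUnit (linMat θ).det) :
    ∃ e : MvPowerSeries (Fin n) K ≃+* MvPowerSeries (Fin n) K, ∀ x, e x = subst θ x := by
  obtain ⟨ψ, hψ0, hψθ, hθψ⟩ := exists_comp_inverse h0 hdet
  have hθ : HasSubst θ := hasSubst_of_constantCoeff_zero h0
  have hψ : HasSubst ψ := hasSubst_of_constantCoeff_zero hψ0
  have h₁ : ∀ x, subst ψ (subst θ x) = x := fun x => by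
    rw [subst_comp_subst_apply hθ hψ, show (fun s => subst ψ (θ s)) = X from funext hψθ, subst_self, id]
  have h₂ : ∀ x, subst θ (subst ψ x) = x := fun x => by
    rw [subst_comp_subst_apply hψ hθ, show (fun s => subst θ (ψ s)) = X from funext hθψ, subst_self, id]
  refine ⟨RingEquiv.ofBijective
      ((substAlgHom hθ : MvPowerSeries (Fin n) K →ₐ[K] MvPowerSeries (Fin n) K) :
        MvPowerSeries (Fin n) K →+* MvPowerSeries (Fin n) K)
      ⟨fun x y hxy => ?_, fun y => ⟨subst ψ y, ?_⟩⟩, fun x => ?_⟩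
  · have h := congrArg (subst ψ) hxy
    change subst ψ ((substAlgHom hθ) x) = subst ψ ((substAlgHom hθ) y) at h
    rwa [substAlgHom_apply, substAlgHom_apply, h₁, h₁] at h
  · change (substAlgHom hθ) (subst ψ y) = y
    rw [substAlgHom_apply, h₂]
  · change (substAlgHom hθ) x = _
    rw [substAlgHom_apply]

/-! ## Row A for an arbitrary competing flag -/

/-- **ROW A DOMINANCE, FLAG FORM** [OURS · L1 W4.3 · (F-3d)]: for a field `K` of characteristic `p` and the
germ `f = X₂^p + Λ X₁^d + X₀^M ∈ K⟦X₀,X₁,X₂⟧` (`p ∤ d`, `p < d`, `Λ ≠ 0`, `N = p r₁ = d r₂ = M q`,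
`0 < q < r₂`), every competing flag `(y'; v')` with `(X₀, v', y') = 𝔪` that carries `f` to level `N` of its
`(q; r₁, r₂)`-filtration weighs `X₁` at least `r₂/q`: `X₁ ∈ F_{(y';v')}(r₂)`. -/
theorem rowA_secondMember_mem_of_frame (p : ℕ) [Fact p.Prime] {K : Type*} [Field K] [CharP K p]
    (d M q r₁ r₂ N : ℕ) (hpd : ¬ p ∣ d) (hlt : p < d) (hN₁ : p * r₁ = N) (hN₂ : d * r₂ = N) (hN₃ : M * q = N)
    (hq : 0 < q) (hqr : q < r₂) (Λ : K) (hΛ : Λ ≠ 0) (y' v' : MvPowerSeries (Fin 3) K)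
    (hframe : Ideal.span {(X 0 : MvPowerSeries (Fin 3) K), v', y'} = maximalIdeal (MvPowerSeries (Fin 3) K))
    (hreach : (X 2 : MvPowerSeries (Fin 3) K) ^ p + C Λ * X 1 ^ d + X 0 ^ M ∈ flagContactFiltration y' v' q r₁ r₂ N) :
    (X 1 : MvPowerSeries (Fin 3) K) ∈ flagContactFiltration y' v' q r₁ r₂ r₂ := by
  -- the automorphism `e : X₀ ↦ X₀, X₁ ↦ v', X₂ ↦ y'` and its inverse `ψ`
  set θ : Fin 3 → MvPowerSeries (Fin 3) K := ![(X 0 : MvPowerSeries (Fin 3) K), v', y'] with hθ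
  have hv0 : constantCoeff v' = 0 :=
    constantCoeff_eq_zero_of_mem_maximalIdeal (hframe ▸ Ideal.subset_span (by simp))
  have hy0 : constantCoeff y' = 0 :=
    constantCoeff_eq_zero_of_mem_maximalIdeal (hframe ▸ Ideal.subset_span (by simp))
  have h0 : ∀ i, constantCoeff (θ i) = 0 := by
    intro i; fin_cases i
    · exact constantCoeff_X 0
    · exact hv0
    · exact hy0
  have hθs : HasSubst θ := hasSubst_of_constantCoeff_zero h0
  obtain ⟨e, he⟩ := exists_ringEquiv_subst h0 (isUnit_det_linMat_frame hframe)
  have he0 : e (X 0) = X 0 := by rw [he, subst_X hθs]; rfl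
  have he1 : e (X 1) = v' := by rw [he, subst_X hθs]; rfl
  have he2 : e (X 2) = y' := by rw [he, subst_X hθs]; rfl
  have heC : e (C Λ) = C Λ := by rw [he, subst_C]
  set ψ := e.symm with hψ
  have hψ0 : ψ (X 0) = X 0 := by rw [hψ, RingEquiv.symm_apply_eq, he0]
  have hψv : ψ v' = X 1 := by rw [hψ, RingEquiv.symm_apply_eq, he1]
  have hψy : ψ y' = X 2 := by rw [hψ, RingEquiv.symm_apply_eq, he2]
  have hψC : ψ (C Λ) = C Λ := by rw [hψ, RingEquiv.symm_apply_eq, heC]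
  -- the germ in the frame `(X₀, ψ X₁, ψ X₂)` against the coordinate flag
  have hreach' : (ψ (X 2)) ^ p + C Λ * (ψ (X 1)) ^ d + X 0 ^ M ∈
      flagContactFiltration (X 2 : MvPowerSeries (Fin 3) K) (X 1) q r₁ r₂ N := by
    have h := (apply_mem_flagContactFiltration_iff ψ ((X 2 : MvPowerSeries (Fin 3) K) ^ p + C Λ * X 1 ^ d + X 0 ^ M)
      y' v' q r₁ r₂ N).mpr hreach
    rwa [hψy, hψv, map_add, map_add, map_pow, map_mul, map_pow, map_pow, hψC, hψ0] at h
  have hframe' : Ideal.span {(X 0 : MvPowerSeries (Fin 3) K), ψ (X 1), ψ (X 2)} =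
      maximalIdeal (MvPowerSeries (Fin 3) K) := by
    apply le_antisymm
    · rw [Ideal.span_le]
      rintro g (rfl | rfl | rfl)
      · exact mem_maximalIdeal_of_constantCoeff_eq_zero (constantCoeff_X 0)
      · exact (map_ringEquiv_maximalIdeal ψ).le
          (Ideal.mem_map_of_mem _ (mem_maximalIdeal_of_constantCoeff_eq_zero (constantCoeff_X 1)))
      · exact (map_ringEquiv_maximalIdeal ψ).le
          (Ideal.mem_map_of_mem _ (mem_maximalIdeal_of_constantCoeff_eq_zero (constantCoeff_X 2)))
    · -- `𝔪 = ψ(𝔪) = ψ((X₀, X₁, X₂)) ⊆ (X₀, ψ X₁, ψ X₂)`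
      rw [← map_ringEquiv_maximalIdeal ψ, maximalIdeal_eq_span_X, Ideal.map_span, Ideal.span_le]
      rintro _ ⟨_, ⟨i, rfl⟩, rfl⟩
      fin_cases i
      · show ψ (X 0) ∈ _
        rw [hψ0]
        exact Ideal.subset_span (by simp)
      · show ψ (X 1) ∈ _
        exact Ideal.subset_span (by simp)
      · show ψ (X 2) ∈ _
        exact Ideal.subset_span (by simp)
  -- Row A in the frame `(X₀, ψ X₁, ψ X₂)`, transported back
  have h := rowA_secondMember_mem p d M q r₁ r₂ N hpd hlt hN₁ hN₂ hN₃ hq hqr Λ hΛ (ψ (X 2)) (ψ (X 1)) hframe' hreach'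
  have h' := apply_mem_flagContactFiltration_iff ψ (X 1 : MvPowerSeries (Fin 3) K) y' v' q r₁ r₂ r₂
  rw [hψy, hψv] at h'
  exact h'.mp h

end Summit.ResolutionOfSingularities.ResolutionOfSingularities.Theorems.LocalEngine.Iota3.RowA
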